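import Literature.Analysis.FluidPDE.PassiveScalarDiagEnergyContinuity
import Literature.Analysis.FluidPDE.PassiveScalarDiagForcedTraceGlobal
import HarnessLib

/-!
# Global weak passive scalars with constant diagonal diffusion and bounded drift: the
# `C([0,∞); L²)` representative, its energy equality, traces and restarts

Analysis/FluidPDE proof file (everything proved; no definitions, no named facts). Continuation of
`PassiveScalarDiagEnergyContinuity` for `L²`-continuous and for global weak solutions of
`∂ₜθ + u·∇θ = κ ∑ᵢ aᵢ ∂ᵢ∂ᵢθ + s` (`Torus.IsWeakScalarTransportDiagForcedOn`, `…DiagForced`; `κ > 0`,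
`aᵢ > 0`, `θ₀ ∈ L²`, `u ∈ L^∞` on every `(0,T) × T^d`, `∫₀ᵀ ‖s‖_{L²} < ∞` for every `T`):

* `IsWeakScalarTransportDiagForcedOn.trace_of_isL2ContinuousOn` / `….translate_of_isL2ContinuousOn` —
  an `L²`-continuous weak solution satisfies the trace identities at EVERY `σ ∈ [0,T]` with the
  datum `θ(σ)`, hence restarts at every `σ ∈ [0,T)` from its own slice: `t ↦ θ(σ + t)` is a weak
  solution from `θ(σ)` (the evolution property, DiPerna–Lions 1989 §II.1/§II.3, through
  `PassiveScalarDiagForcedRestart.translate`);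
* `IsWeakScalarTransportDiagForced.exists_l2Continuous_representative` — every GLOBAL weak solution
  agrees for a.e. `t > 0` with a global weak solution `w ∈ C([0,∞); L²)`
  (`Torus.IsL2ContinuousOn (Ici 0) w`) with `w(0) = θ₀`, satisfying the energy EQUALITY
  `‖w(t₂)‖² + 2κ∫_{t₁}^{t₂}‖∇w‖²_a = ‖w(t₁)‖² + 2∫_{t₁}^{t₂}∫ s w` for EVERY `0 ≤ t₁ ≤ t₂`, and
  restarting from `w(σ)` at EVERY `σ ≥ 0` (Temam 1979, Ch. III §1 Lemma 1.2 for this class, horizon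
  by horizon, from the global weakly continuous representative of `PassiveScalarDiagForcedTraceGlobal`);
* `IsWeakScalarTransportDiagForced.energy_eq_sub_of_isL2ContinuousOn`,
  `….translate_of_isL2ContinuousOn`, `….restart_natMulPeriod_of_isL2ContinuousOn` — the same three
  properties for ANY global weak solution which is `L²`-continuous on `[0,∞)`; the last one is the
  form read by charge–discharge bookkeeping over an `L`-periodic drift and a steady source:
  `t ↦ θ(nL + t)` solves the SAME problem from the datum `θ(nL)`, for every `n`;
* `….integral_eq_of_isL2ContinuousOn` / `….integral_eq_zero_of_isL2ContinuousOn` (finite horizon and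
  global) — the mean at EVERY time, `∫ θ(σ) = ∫ θ₀ + ∫_{(0,σ]} ∫ s`, and preservation of mean zero
  (the data class of the Hess-Childs–Rowan statements at restarts).

## Mathlib / tree search

Tree (reused): `exists_weaklyContinuous_representative` (global, `…TraceGlobal`),
`IsWeakScalarTransportDiagForced.translate / restart_natMulPeriod` (`…RestartGlobal`),
`IsWeakScalarTransportDiagForcedOn.translate`, `ae_integral_mul_eq`, `continuousOn_pairingPrimitive`,
`energy_eq_of_representative`, `isL2ContinuousOn_of_weaklyContinuous`,
`energy_eq_sub_of_isL2ContinuousOn`; Mathlib `nhdsWithin_restrict'`, `nhdsWithin_mono`.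

## References

* R. Temam, *Navier–Stokes Equations* (North-Holland 1979), Ch. III §1, Lemma 1.2. [`Temam1979`]
* R. J. DiPerna, P.-L. Lions, Invent. Math. 98 (1989), §II.1 (12)–(14), §II.3. [`DiPernaLions1989`]
* P. Bonicatto, G. Ciampa, G. Crippa, J. Evol. Equ. 24 (2024), Thm. 3.3, (3.4), Remark 3.4.
  [`BonicattoCiampaCrippa2023`]
-/

noncomputable section

open _root_.MeasureTheory _root_.Set _root_.Filter _root_.Function _root_.TopologicalSpace
open scoped ENNReal NNReal InnerProductSpace ContDiff Topology
open Literature.Analysis.FunctionSpaces.Torus Literature.Analysis.FunctionSpaces UnitAddTorus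

namespace Literature.Analysis.FluidPDE

variable {d : Type*} [Fintype d] [DecidableEq d]

namespace Torus

/-! ## Tool: `C([0,∞); L²)` from `C([0,T]; L²)` for every `T` -/

omit [DecidableEq d] in
/-- `L²`-continuity on `[0,∞)` from `L²`-continuity on every `[0,T]`, `T > 0` (the class
`C([0,∞); L²)` assembled from the classes `C([0,T]; L²)`; `[0,T+1)` is a neighbourhood of `t₀ ≤ T`
within `[0,∞)`). [cite: ArmstrongVicol2025, Thm. 1.1 p. 3 (the class `C([0,1];L²(T^d))`)] -/
theorem isL2ContinuousOn_Ici_of_forall_Icc {θ : ℝ → UnitAddTorus d → ℝ}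
    (h : ∀ T : ℝ, 0 < T → IsL2ContinuousOn (Icc 0 T) θ) : IsL2ContinuousOn (Ici 0) θ := by
  refine ⟨fun t ht => (h (t + 1) (by linarith [mem_Ici.1 ht])).memLp ⟨mem_Ici.1 ht, by linarith⟩,
    fun t₀ ht₀ => ?_⟩
  have ht₀' : 0 ≤ t₀ := mem_Ici.1 ht₀
  have hc := (h (t₀ + 1) (by linarith)).tendsto (t₀ := t₀) ⟨ht₀', by linarith⟩
  rw [nhdsWithin_restrict' (Ici (0 : ℝ)) (Iio_mem_nhds (show t₀ < t₀ + 1 by linarith))]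
  exact hc.mono_left (nhdsWithin_mono _ fun t ht => ⟨mem_Ici.1 ht.1, (mem_Iio.1 ht.2).le⟩)

namespace IsWeakScalarTransportDiagForcedOn

variable {T κ : ℝ} {a : d → ℝ} {u : ℝ → UnitAddTorus d → EuclideanSpace ℝ d} {s : ℝ → UnitAddTorus d → ℝ}
  {θ₀ : UnitAddTorus d → ℝ} {θ : ℝ → UnitAddTorus d → ℝ}

/-! ## Traces and restarts of `L²`-continuous weak solutions (finite horizon) -/

/-- **An `L²`-continuous weak solution satisfies the trace identities at every time with its own
slice as datum**: for `θ ∈ C([0,T]; L²)`, every smooth steady `g` and EVERY `σ ∈ [0,T]`,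
`∫ θ(σ) g = ∫ θ₀ g + ∫_{(0,σ]} (∫ θ (⟪u, ∇g⟫ + κ ∑ᵢ aᵢ ∂ᵢ∂ᵢ g) + ∫ s g)` (both sides are continuous
on `[0,T]` — the left by strong continuity, the right as a primitive — and agree a.e. by
`ae_integral_mul_eq`). [cite: DiPernaLions1989, §II.1 (13)–(14)] -/
theorem trace_of_isL2ContinuousOn (h : IsWeakScalarTransportDiagForcedOn T a κ u s θ₀ θ) (hT : 0 < T)
    (hc : IsL2ContinuousOn (Icc 0 T) θ) {g : UnitAddTorus d → ℝ} (hg : IsSmooth g) {σ : ℝ}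
    (hσ : σ ∈ Icc 0 T) :
    ∫ x, θ σ x * g x = (∫ x, θ₀ x * g x) +
      ∫ τ in Ioc 0 σ, ((∫ x, θ τ x * (⟪u τ x, gradient g x⟫_ℝ +
        κ * ∑ i, a i * FunctionSpaces.Torus.partialDeriv i (FunctionSpaces.Torus.partialDeriv i g) x)) +
        ∫ x, s τ x * g x) := by
  have hf : ContinuousOn (fun t => ∫ x, θ t x * g x) (Icc 0 T) := hc.continuousOn_integral_mul (hg.memLp 2)
  have hP := h.continuousOn_pairingPrimitive hg
  have key : EqOn (fun t => ∫ x, θ t x * g x) (fun t => (∫ x, θ₀ x * g x) +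
      ∫ τ in Ioc 0 t, ((∫ x, θ τ x * (⟪u τ x, gradient g x⟫_ℝ +
        κ * ∑ i, a i * FunctionSpaces.Torus.partialDeriv i (FunctionSpaces.Torus.partialDeriv i g) x)) +
        ∫ x, s τ x * g x)) (Icc 0 T) := by
    refine Measure.eqOn_Icc_of_ae_eq (μ := volume) hT.ne ?_ hf hP
    have e : (volume : Measure ℝ).restrict (Icc 0 T) = volume.restrict (Ioo 0 T) :=
      Measure.restrict_congr_set Ioo_ae_eq_Icc.symm
    rw [e]
    exact h.ae_integral_mul_eq hg
  exact key hσ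

/-- **An `L²`-continuous weak solution restarts at every time from its own slice**: for
`θ ∈ C([0,T]; L²)` and `σ ∈ [0,T)`, the translate `t ↦ θ(σ + t)` is a weak solution on
`T^d × [0, T-σ)` with drift `u(σ + ·)`, source `s(σ + ·)` and datum `θ(σ)` (the evolution
property, DiPerna–Lions 1989 §II.1/§II.3, via `translate` and `trace_of_isL2ContinuousOn`).
[cite: DiPernaLions1989, §II.1 (12)–(14)] -/
theorem translate_of_isL2ContinuousOn (h : IsWeakScalarTransportDiagForcedOn T a κ u s θ₀ θ)
    (hc : IsL2ContinuousOn (Icc 0 T) θ) {σ : ℝ} (hσ : 0 ≤ σ) (hσT : σ < T) :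
    IsWeakScalarTransportDiagForcedOn (T - σ) a κ (fun t => u (σ + t)) (fun t => s (σ + t)) (θ σ)
      (fun t => θ (σ + t)) :=
  h.translate hσ hσT fun _ hg => h.trace_of_isL2ContinuousOn (hσ.trans_lt hσT) hc hg ⟨hσ, hσT.le⟩

end IsWeakScalarTransportDiagForcedOn

namespace IsWeakScalarTransportDiagForced

variable {κ : ℝ} {a : d → ℝ} {u : ℝ → UnitAddTorus d → EuclideanSpace ℝ d} {s : ℝ → UnitAddTorus d → ℝ}
  {θ₀ : UnitAddTorus d → ℝ} {θ : ℝ → UnitAddTorus d → ℝ}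

/-! ## Global `L²`-continuous weak solutions: energy equality, traces, restarts -/

/-- **Energy equality between every pair of times for a global `L²`-continuous weak solution**:
for `θ ∈ C([0,∞); L²)` solving `∂ₜθ + u·∇θ = κ ∑ᵢ aᵢ ∂ᵢ∂ᵢθ + s` globally (`κ > 0`, `aᵢ > 0`,
`θ₀ ∈ L²`, `u` bounded and `s ∈ L¹_t L²_x` on every horizon) and all `0 ≤ t₁ ≤ t₂`,
`‖θ(t₂)‖²_{L²} + 2κ ∫_{t₁}^{t₂} ‖∇θ‖²_a = ‖θ(t₁)‖²_{L²} + 2 ∫_{t₁}^{t₂} ∫ s θ`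
(Bonicatto–Ciampa–Crippa 2024 Thm. 3.3 / (3.4) / Remark 3.4, time-pointwise; horizon `t₂ + 1`).
[cite: BonicattoCiampaCrippa2023, Thm. 3.3, (3.4) and Remark 3.4] -/
theorem energy_eq_sub_of_isL2ContinuousOn (h : IsWeakScalarTransportDiagForced a κ u s θ₀ θ)
    (hκ : 0 < κ) (ha : ∀ i, 0 < a i) (hθ₀ : MemLp θ₀ 2 volume)
    (hu : ∀ T : ℝ, 0 < T → MemLp (stLift u) ⊤ (volume.restrict (Ioo 0 T ×ˢ univ)))
    (hs : ∀ T : ℝ, 0 < T → ∫⁻ t in Ioo 0 T, (∫⁻ x, ‖s t x‖ₑ ^ 2) ^ (1 / 2 : ℝ) < ⊤)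
    (hc : IsL2ContinuousOn (Ici 0) θ) {t₁ t₂ : ℝ} (ht₁ : 0 ≤ t₁) (h12 : t₁ ≤ t₂) :
    (∫ x, θ t₂ x ^ 2) + 2 * κ * (∫⁻ τ in Ioo t₁ t₂, Torus.eScalarGradNormSqDiag a (θ τ)).toReal =
      (∫ x, θ t₁ x ^ 2) + 2 * ∫ τ in Ioo t₁ t₂, ∫ x, s τ x * θ τ x := by
  have hT : 0 < t₂ + 1 := by linarith
  exact (h (t₂ + 1) hT).energy_eq_sub_of_isL2ContinuousOn hT hκ ha hθ₀ (hu _ hT) (hs _ hT)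
    (hc.mono Icc_subset_Ici_self) ht₁ h12 (by linarith)

/-- **A global `L²`-continuous weak solution restarts at every `σ ≥ 0` from its own slice**:
`t ↦ θ(σ + t)` is a global weak solution with drift `u(σ + ·)`, source `s(σ + ·)` and datum
`θ(σ)`. [cite: DiPernaLions1989, §II.1 (12)–(14)] -/
theorem translate_of_isL2ContinuousOn (h : IsWeakScalarTransportDiagForced a κ u s θ₀ θ)
    (hc : IsL2ContinuousOn (Ici 0) θ) {σ : ℝ} (hσ : 0 ≤ σ) :
    IsWeakScalarTransportDiagForced a κ (fun t => u (σ + t)) (fun t => s (σ + t)) (θ σ)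
      (fun t => θ (σ + t)) := by
  have hT : 0 < σ + 1 := by linarith
  exact h.translate hσ fun _ hg => (h (σ + 1) hT).trace_of_isL2ContinuousOn hT
    (hc.mono Icc_subset_Ici_self) hg ⟨hσ, by linarith⟩

/-- **Restart at integer multiples of the period, for a global `L²`-continuous weak solution**
(the form read by charge–discharge bookkeeping): for a drift `L`-periodic on `t ≥ 0` (`L ≥ 0`)
and a steady source `S`, `t ↦ θ(nL + t)` is a global weak solution of the SAME problem (drift `u`,
source `S`) from the datum `θ(nL)`, for every `n`. [cite: DiPernaLions1989, §II.1 (12)–(14)] -/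
theorem restart_natMulPeriod_of_isL2ContinuousOn {S : UnitAddTorus d → ℝ} {L : ℝ} (hL : 0 ≤ L)
    (hu : ∀ t : ℝ, 0 ≤ t → u (t + L) = u t)
    (h : IsWeakScalarTransportDiagForced a κ u (fun _ => S) θ₀ θ) (hc : IsL2ContinuousOn (Ici 0) θ)
    (n : ℕ) :
    IsWeakScalarTransportDiagForced a κ u (fun _ => S) (θ ((n : ℝ) * L)) (fun t => θ ((n : ℝ) * L + t)) := by
  have hσ : 0 ≤ (n : ℝ) * L := by positivity
  have hT : 0 < (n : ℝ) * L + 1 := by linarith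
  exact h.restart_natMulPeriod hL hu n fun _ hg => (h _ hT).trace_of_isL2ContinuousOn hT
    (hc.mono Icc_subset_Ici_self) hg ⟨hσ, by linarith⟩

/-- **Every global weak passive scalar with constant diagonal diffusion, bounded drift and an
`L¹_{t,loc} L²_x` source is a `C([0,∞); L²)` solution after modification on a null set of times.**
For `κ > 0`, `aᵢ > 0`, `θ₀ ∈ L²(T^d)`, a drift `u` bounded on every `(0,T) × T^d` (weakly
divergence free for a.e. `t`, part of the class), a source with `∫₀ᵀ ‖s(t)‖_{L²} dt < ∞` for every
`T`, and every global weak solution `θ` (`Torus.IsWeakScalarTransportDiagForced a κ u s θ₀ θ`), there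
is a global weak solution `w` of the same problem with `w(t) = θ(t)` a.e. for a.e. `t > 0`,
`w(0) = θ₀`, `w ∈ C([0,∞); L²)` STRONGLY (`Torus.IsL2ContinuousOn (Ici 0) w`), satisfying the energy
EQUALITY `‖w(t₂)‖² + 2κ ∫_{t₁}^{t₂} ‖∇w‖²_a = ‖w(t₁)‖² + 2 ∫_{t₁}^{t₂} ∫ s w` for EVERY
`0 ≤ t₁ ≤ t₂`, and restarting from `w(σ)` at EVERY `σ ≥ 0` (`t ↦ w(σ + t)` solves with drift
`u(σ + ·)`, source `s(σ + ·)`, datum `w(σ)`). Temam 1979, Ch. III §1, Lemma 1.2 for this class: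
the global weakly continuous representative (`exists_weaklyContinuous_representative`) satisfies the
energy equality at every time of every horizon (`energy_eq_of_representative`), so its energy is
continuous and Radon–Riesz (`isL2ContinuousOn_of_weaklyContinuous`) gives strong continuity on every
`[0,T]`, hence on `[0,∞)`; the slice at `0` is set equal to `θ₀`. [cite: Temam1979, Ch. III §1 Lemma 1.2] -/
theorem exists_l2Continuous_representative [Nonempty d] (h : IsWeakScalarTransportDiagForced a κ u s θ₀ θ)
    (hκ : 0 < κ) (ha : ∀ i, 0 < a i) (hθ₀ : MemLp θ₀ 2 volume)
    (hu : ∀ T : ℝ, 0 < T → MemLp (stLift u) ⊤ (volume.restrict (Ioo 0 T ×ˢ univ)))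
    (hs : ∀ T : ℝ, 0 < T → ∫⁻ t in Ioo 0 T, (∫⁻ x, ‖s t x‖ₑ ^ 2) ^ (1 / 2 : ℝ) < ⊤) :
    ∃ w : ℝ → UnitAddTorus d → ℝ,
      IsWeakScalarTransportDiagForced a κ u s θ₀ w ∧
      IsL2ContinuousOn (Ici 0) w ∧ w 0 = θ₀ ∧
      (∀ᵐ t ∂(volume.restrict (Ioi 0)), w t =ᵐ[volume] θ t) ∧
      (∀ ⦃t₁ t₂ : ℝ⦄, 0 ≤ t₁ → t₁ ≤ t₂ →
        (∫ x, w t₂ x ^ 2) + 2 * κ * (∫⁻ τ in Ioo t₁ t₂, Torus.eScalarGradNormSqDiag a (w τ)).toReal =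
          (∫ x, w t₁ x ^ 2) + 2 * ∫ τ in Ioo t₁ t₂, ∫ x, s τ x * w τ x) ∧
      ∀ σ : ℝ, 0 ≤ σ → IsWeakScalarTransportDiagForced a κ (fun t => u (σ + t)) (fun t => s (σ + t)) (w σ)
        (fun t => w (σ + t)) := by
  obtain ⟨v, hvm, hv2, -, hvae, hvc, -⟩ := h.exists_weaklyContinuous_representative
  -- on every horizon: continuous coefficients, energy equality at every time, strong continuity
  have hvT : ∀ T : ℝ, 0 < T → IsL2ContinuousOn (Icc 0 T) v := by
    intro T hT
    have hv2' : ∀ t ∈ Icc 0 T, MemLp (v t) 2 volume := fun t ht => hv2 t ht.1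
    have hvc' : ∀ g : UnitAddTorus d → ℝ, MemLp g 2 volume →
        ContinuousOn (fun t => ∫ x, v t x * g x) (Icc 0 T) := fun g hg => (hvc g hg).mono Icc_subset_Ici_self
    have hvae' : ∀ᵐ t ∂(volume.restrict (Ioo 0 T)), v t =ᵐ[volume] θ t :=
      ae_restrict_of_ae_restrict_of_subset Ioo_subset_Ioi_self hvae
    have hvcoef := continuousOn_mFourierCoeff_of_weaklyContinuous hv2' hvc'
    have hEv := (h T hT).energy_eq_of_representative hT hκ ha hθ₀ (hu T hT) (hs T hT) hv2' hvae' hvcoef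
    obtain ⟨hDint, hDeq⟩ := (h T hT).integrableOn_toReal_eScalarGradNormSqDiag hκ ha hθ₀ (hu T hT) (hs T hT)
    have hsI := (h T hT).integrableOn_integral_source_mul (hs T hT)
    have hR : ContinuousOn (fun t => (∫ x, θ₀ x ^ 2) + 2 * (∫ τ in Ioc 0 t, ∫ x, s τ x * θ τ x) -
        2 * κ * ∫ τ in Ioc 0 t, (Torus.eScalarGradNormSqDiag a (θ τ)).toReal) (Icc 0 T) :=
      (continuousOn_const.add (continuousOn_const.mul
        (intervalIntegral.continuousOn_primitive (hsI.congr_set_ae Ioo_ae_eq_Icc.symm)))).sub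
        (continuousOn_const.mul (intervalIntegral.continuousOn_primitive (hDint.congr_set_ae Ioo_ae_eq_Icc.symm)))
    have hE : ContinuousOn (fun t => ∫ x, v t x ^ 2) (Icc 0 T) := by
      refine hR.congr fun t ht => ?_
      have e := hEv t ht
      rw [← hDeq t ht.2, setIntegral_congr_set (Ioo_ae_eq_Ioc (μ := (volume : Measure ℝ)) (a := 0) (b := t)),
        setIntegral_congr_set (Ioo_ae_eq_Ioc (μ := (volume : Measure ℝ)) (a := 0) (b := t))] at e
      show ∫ x, v t x ^ 2 = _
      linarith
    exact isL2ContinuousOn_of_weaklyContinuous hv2' hvc' hE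
  have hvL2 : IsL2ContinuousOn (Ici 0) v := isL2ContinuousOn_Ici_of_forall_Icc hvT
  -- `v 0 = θ₀` a.e. (horizon `1`)
  have hv0 : v 0 =ᵐ[volume] θ₀ :=
    (h 1 one_pos).representative_zero_ae_eq one_pos hθ₀ (hv2 0 le_rfl)
      (ae_restrict_of_ae_restrict_of_subset Ioo_subset_Ioi_self hvae)
      (continuousOn_mFourierCoeff_of_weaklyContinuous (fun t ht => hv2 t ht.1)
        fun g hg => (hvc g hg).mono Icc_subset_Ici_self)
  -- the modified field
  set w : ℝ → UnitAddTorus d → ℝ := Function.update v 0 θ₀ with hw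
  have hw_of_ne : ∀ {t : ℝ}, t ≠ 0 → w t = v t := fun ht => by rw [hw, Function.update_of_ne ht]
  have hw0 : w 0 = θ₀ := by rw [hw, Function.update_self]
  have hwv : ∀ t ∈ Ici (0 : ℝ), w t =ᵐ[volume] v t := by
    intro t _
    rcases eq_or_ne t 0 with rfl | hne
    · rw [hw0]; exact hv0.symm
    · rw [hw_of_ne hne]
  have hwae : ∀ᵐ t ∂(volume.restrict (Ioi 0)), w t =ᵐ[volume] θ t := by
    filter_upwards [hvae, ae_restrict_mem measurableSet_Ioi] with t ht htI
    rw [hw_of_ne (mem_Ioi.1 htI).ne']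
    exact ht
  have hwsol : IsWeakScalarTransportDiagForced a κ u s θ₀ w := by
    intro T hT
    have hwm : AEStronglyMeasurable (stLift w) (volume.restrict (Ioo 0 T ×ˢ univ)) := by
      refine (hvm.mono_measure (Measure.restrict_mono (Set.prod_mono Ioo_subset_Ioi_self le_rfl) le_rfl)).congr ?_
      filter_upwards [ae_restrict_mem (measurableSet_Ioo.prod MeasurableSet.univ)] with p hp
      obtain ⟨t, y⟩ := p
      simp only [FunctionSpaces.Torus.stLift_apply, hw_of_ne (mem_prod.1 hp).1.1.ne']
    exact (h T hT).congr_ae_slice hwm (ae_restrict_of_ae_restrict_of_subset Ioo_subset_Ioi_self hwae)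
  have hwL2 : IsL2ContinuousOn (Ici 0) w := by
    refine ⟨fun t ht => (hvL2.1 t ht).ae_eq (hwv t ht).symm, fun t₀ ht₀ => ?_⟩
    refine (hvL2.2 t₀ ht₀).congr' ?_
    filter_upwards [self_mem_nhdsWithin] with t ht
    refine integral_congr_ae ?_
    filter_upwards [hwv t ht, hwv t₀ ht₀] with x hx hx₀
    simp only [Pi.sub_apply, hx, hx₀]
  refine ⟨w, hwsol, hwL2, hw0, hwae, fun t₁ t₂ ht₁ h12 => ?_, fun σ hσ => ?_⟩
  · exact hwsol.energy_eq_sub_of_isL2ContinuousOn hκ ha hθ₀ hu hs hwL2 ht₁ h12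
  · exact hwsol.translate_of_isL2ContinuousOn hwL2 hσ

end IsWeakScalarTransportDiagForced

/-! ## Means of `L²`-continuous weak solutions -/

namespace IsWeakScalarTransportDiagForcedOn

variable {T κ : ℝ} {a : d → ℝ} {u : ℝ → UnitAddTorus d → EuclideanSpace ℝ d} {s : ℝ → UnitAddTorus d → ℝ}
  {θ₀ : UnitAddTorus d → ℝ} {θ : ℝ → UnitAddTorus d → ℝ}

/-- **The mean of an `L²`-continuous weak solution at every time**: for `θ ∈ C([0,T]; L²)` and
EVERY `σ ∈ [0,T]`, `∫ θ(σ) = ∫ θ₀ + ∫_{(0,σ]} ∫ s(τ) dτ` (the trace identity with `g = 1`: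
transport and diffusion do not change the mean). [cite: DiPernaLions1989, §II.1 (13)–(14)] -/
theorem integral_eq_of_isL2ContinuousOn (h : IsWeakScalarTransportDiagForcedOn T a κ u s θ₀ θ)
    (hT : 0 < T) (hc : IsL2ContinuousOn (Icc 0 T) θ) {σ : ℝ} (hσ : σ ∈ Icc 0 T) :
    ∫ x, θ σ x = (∫ x, θ₀ x) + ∫ τ in Ioc 0 σ, ∫ x, s τ x :=
  h.integral_trace_eq fun _ hg => h.trace_of_isL2ContinuousOn hT hc hg hσ

/-- **Mean zero is preserved at every time**: if `∫ θ₀ = 0` and `∫ s(τ) = 0` for a.e. `τ ∈ (0,T)`,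
then `∫ θ(σ) = 0` for EVERY `σ ∈ [0,T]` and every `L²`-continuous weak solution (the mean-zero
data class of the Hess-Childs–Rowan statements is preserved along the evolution and at restarts).
[cite: DiPernaLions1989, §II.1 (13)–(14)] -/
theorem integral_eq_zero_of_isL2ContinuousOn (h : IsWeakScalarTransportDiagForcedOn T a κ u s θ₀ θ)
    (hT : 0 < T) (hc : IsL2ContinuousOn (Icc 0 T) θ) (hθ₀ : ∫ x, θ₀ x = 0)
    (hs0 : ∀ᵐ τ ∂(volume.restrict (Ioo 0 T)), ∫ x, s τ x = 0) {σ : ℝ} (hσ : σ ∈ Icc 0 T) :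
    ∫ x, θ σ x = 0 := by
  rw [h.integral_eq_of_isL2ContinuousOn hT hc hσ, hθ₀, zero_add]
  have e : (volume : Measure ℝ).restrict (Ioo 0 T) = volume.restrict (Icc 0 T) :=
    Measure.restrict_congr_set Ioo_ae_eq_Icc
  rw [e] at hs0
  exact integral_eq_zero_of_ae
    (ae_restrict_of_ae_restrict_of_subset (Ioc_subset_Icc_self.trans (Icc_subset_Icc le_rfl hσ.2)) hs0)

end IsWeakScalarTransportDiagForcedOn

namespace IsWeakScalarTransportDiagForced

variable {κ : ℝ} {a : d → ℝ} {u : ℝ → UnitAddTorus d → EuclideanSpace ℝ d} {s : ℝ → UnitAddTorus d → ℝ}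
  {θ₀ : UnitAddTorus d → ℝ} {θ : ℝ → UnitAddTorus d → ℝ}

/-- **The mean of a global `L²`-continuous weak solution at every time `σ ≥ 0`**:
`∫ θ(σ) = ∫ θ₀ + ∫_{(0,σ]} ∫ s(τ) dτ`. [cite: DiPernaLions1989, §II.1 (13)–(14)] -/
theorem integral_eq_of_isL2ContinuousOn (h : IsWeakScalarTransportDiagForced a κ u s θ₀ θ)
    (hc : IsL2ContinuousOn (Ici 0) θ) {σ : ℝ} (hσ : 0 ≤ σ) :
    ∫ x, θ σ x = (∫ x, θ₀ x) + ∫ τ in Ioc 0 σ, ∫ x, s τ x := by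
  have hT : 0 < σ + 1 := by linarith
  exact (h (σ + 1) hT).integral_eq_of_isL2ContinuousOn hT (hc.mono Icc_subset_Ici_self) ⟨hσ, by linarith⟩

/-- **Mean zero is preserved along a global `L²`-continuous weak solution**: `∫ θ₀ = 0` and
`∫ s(τ) = 0` for a.e. `τ > 0` give `∫ θ(σ) = 0` for EVERY `σ ≥ 0` (e.g. a steady mean-zero source;
the restart data `θ(nL)` of the charge–discharge bookkeeping are mean-zero).
[cite: DiPernaLions1989, §II.1 (13)–(14)] -/
theorem integral_eq_zero_of_isL2ContinuousOn (h : IsWeakScalarTransportDiagForced a κ u s θ₀ θ)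
    (hc : IsL2ContinuousOn (Ici 0) θ) (hθ₀ : ∫ x, θ₀ x = 0)
    (hs0 : ∀ᵐ τ ∂(volume.restrict (Ioi 0)), ∫ x, s τ x = 0) {σ : ℝ} (hσ : 0 ≤ σ) :
    ∫ x, θ σ x = 0 := by
  have hT : 0 < σ + 1 := by linarith
  exact (h (σ + 1) hT).integral_eq_zero_of_isL2ContinuousOn hT (hc.mono Icc_subset_Ici_self) hθ₀
    (ae_restrict_of_ae_restrict_of_subset Ioo_subset_Ioi_self hs0) ⟨hσ, by linarith⟩

end IsWeakScalarTransportDiagForced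

end Torus

end Literature.Analysis.FluidPDE

end
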